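import Summits.NavierStokesRegularity.FunctionalMining.NoGo.PairIntegrals
import Mathlib.Analysis.SpecialFunctions.Integrals.Basic
import HarnessLib

/-!
# The oscillatory packet profile `g_K(t) = φ(t) cos(Kt)/K²`: derivatives and `L²` asymptotics

Search for candidate a priori estimates; no regularity claim. NS FUNCTIONAL MINING — NO-GO BRANCH
(cell `pub-nsfunc`, prove seat gen 3); the `y`-profile of the log-door packet
(`NoGo/LogDoorPacket.lean`). For a smooth envelope `φ` vanishing off `[-2,2]`:
* `gK φ K t = (K²)⁻¹ φ(t) cos(Kt)` and its first three derivatives in the form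
  `A(t) cos(Kt) + B(t) sin(Kt)` (`iteratedDeriv_gK_one/two/three`);
* uniform bounds for `K ≥ 1`: `|g_K⁽ˡ⁾| ≤ C_l` for `l ≤ 2` and `|g_K''' − K φ sin(K·)| ≤ C₃`
  with constants depending only on sup-norms of `φ, φ', φ'', φ'''` (`abs_iteratedDeriv_gK_le_…`);
* consequently `Sq (gK φ K) l ≤ 4 C_l²` for `l ≤ 2` and, if `φ = 1` on `[-r, r]`,
  `Sq (gK φ K) 3 ≥ K² r/2 − K/2 − 4 C₃²` (`Sq_gK_three_ge`): the packet's `‖g'''‖₂²` grows like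
  `K²` while all lower Sobolev quantities stay bounded.
Folklore calculus; nothing is asserted about Navier–Stokes.
-/

open MeasureTheory Set Function Real
open scoped ContDiff

namespace Summit.NavierStokesRegularity.FunctionalMining

namespace Sep3

section Osc

variable {φ : ℝ → ℝ} {K : ℝ}

/-- `0 ≤ ∞` in `WithTop ℕ∞`. [folklore] -/
private theorem zero_le_infty : (0 : WithTop ℕ∞) ≤ ∞ := by
  change ((0 : ℕ∞) : WithTop ℕ∞) ≤ ((⊤ : ℕ∞) : WithTop ℕ∞)
  exact_mod_cast (le_top : (0 : ℕ∞) ≤ ⊤)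

/-- `3 ≤ ∞` in `WithTop ℕ∞`. [folklore] -/
private theorem three_le_infty : (3 : WithTop ℕ∞) ≤ ∞ := by
  change ((3 : ℕ∞) : WithTop ℕ∞) ≤ ((⊤ : ℕ∞) : WithTop ℕ∞)
  exact_mod_cast (le_top : (3 : ℕ∞) ≤ ⊤)

/-- The packet profile `g_K(t) = (K²)⁻¹ φ(t) cos(K t)`. [folklore] -/
noncomputable def gK (φ : ℝ → ℝ) (K : ℝ) (t : ℝ) : ℝ := (K ^ 2)⁻¹ * (φ t * cos (K * t))

/-- `g_K` is smooth. [folklore] -/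
theorem contDiff_gK (hφ : ContDiff ℝ ∞ φ) (K : ℝ) : ContDiff ℝ ∞ (gK φ K) :=
  contDiff_const.mul (hφ.mul (contDiff_cos.comp (contDiff_const.mul contDiff_id)))

/-- `g_K` vanishes where `φ` does. [folklore] -/
theorem gK_eq_zero (h0 : ∀ t, 2 < |t| → φ t = 0) (K : ℝ) : ∀ t, 2 < |t| → gK φ K t = 0 := by
  intro t ht; simp [gK, h0 t ht]

/-- Derivative of `A cos(K·) + B sin(K·)`. [folklore] -/
theorem hasDerivAt_cos_sin {A B : ℝ → ℝ} {A' B' : ℝ} (K t : ℝ) (hA : HasDerivAt A A' t)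
    (hB : HasDerivAt B B' t) :
    HasDerivAt (fun s => A s * cos (K * s) + B s * sin (K * s))
      ((A' + K * B t) * cos (K * t) + (B' - K * A t) * sin (K * t)) t := by
  have hK : HasDerivAt (fun s : ℝ => K * s) K t := by
    simpa using (hasDerivAt_id t).const_mul K
  have hc : HasDerivAt (fun s => cos (K * s)) (-sin (K * t) * K) t := (hasDerivAt_cos (K * t)).comp t hK
  have hs : HasDerivAt (fun s => sin (K * s)) (cos (K * t) * K) t := (hasDerivAt_sin (K * t)).comp t hK
  have h := (hA.mul hc).add (hB.mul hs)
  refine h.congr_deriv ?_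
  ring

/-- `g_K = A₀ cos + B₀ sin` with `A₀ = (K²)⁻¹ φ`, `B₀ = 0`. [folklore] -/
theorem gK_eq (φ : ℝ → ℝ) (K : ℝ) :
    gK φ K = fun t => (K ^ 2)⁻¹ * iteratedDeriv 0 φ t * cos (K * t) + 0 * sin (K * t) := by
  funext t; simp [gK, iteratedDeriv_zero]; ring

/-- `g_K' = (K²)⁻¹ φ' cos(K·) − (K²)⁻¹ K φ sin(K·)`. [folklore] -/
theorem iteratedDeriv_gK_one (hφ : ContDiff ℝ ∞ φ) (K : ℝ) :
    iteratedDeriv 1 (gK φ K) = fun t =>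
      (K ^ 2)⁻¹ * iteratedDeriv 1 φ t * cos (K * t) + (-((K ^ 2)⁻¹ * K * iteratedDeriv 0 φ t)) * sin (K * t) := by
  rw [iteratedDeriv_one, gK_eq]
  funext t
  have hA : HasDerivAt (fun s => (K ^ 2)⁻¹ * iteratedDeriv 0 φ s) ((K ^ 2)⁻¹ * iteratedDeriv 1 φ t) t :=
    (hasDerivAt_iteratedDeriv hφ 0 t).const_mul _
  have hB : HasDerivAt (fun _ : ℝ => (0 : ℝ)) 0 t := hasDerivAt_const t 0
  rw [(hasDerivAt_cos_sin K t hA hB).deriv]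
  ring

/-- `g_K'' = (K²)⁻¹ (φ'' − K²φ) cos(K·) − 2 (K²)⁻¹ K φ' sin(K·)`. [folklore] -/
theorem iteratedDeriv_gK_two (hφ : ContDiff ℝ ∞ φ) (K : ℝ) :
    iteratedDeriv 2 (gK φ K) = fun t =>
      (K ^ 2)⁻¹ * (iteratedDeriv 2 φ t - K ^ 2 * iteratedDeriv 0 φ t) * cos (K * t) +
        (-(2 * (K ^ 2)⁻¹ * K * iteratedDeriv 1 φ t)) * sin (K * t) := by
  rw [show (2 : ℕ) = 1 + 1 from rfl, iteratedDeriv_succ, iteratedDeriv_gK_one hφ]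
  funext t
  have hA : HasDerivAt (fun s => (K ^ 2)⁻¹ * iteratedDeriv 1 φ s) ((K ^ 2)⁻¹ * iteratedDeriv 2 φ t) t :=
    (hasDerivAt_iteratedDeriv hφ 1 t).const_mul _
  have hB : HasDerivAt (fun s => -((K ^ 2)⁻¹ * K * iteratedDeriv 0 φ s))
      (-((K ^ 2)⁻¹ * K * iteratedDeriv 1 φ t)) t :=
    ((hasDerivAt_iteratedDeriv hφ 0 t).const_mul _).neg
  rw [(hasDerivAt_cos_sin K t hA hB).deriv]
  ring

/-- `g_K''' = (K²)⁻¹ (φ''' − 3K²φ') cos(K·) + (K²)⁻¹ (K³ φ − 3K φ'') sin(K·)`. [folklore] -/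
theorem iteratedDeriv_gK_three (hφ : ContDiff ℝ ∞ φ) (K : ℝ) :
    iteratedDeriv 3 (gK φ K) = fun t =>
      (K ^ 2)⁻¹ * (iteratedDeriv 3 φ t - 3 * K ^ 2 * iteratedDeriv 1 φ t) * cos (K * t) +
        (K ^ 2)⁻¹ * (K ^ 3 * iteratedDeriv 0 φ t - 3 * K * iteratedDeriv 2 φ t) * sin (K * t) := by
  rw [show (3 : ℕ) = 2 + 1 from rfl, iteratedDeriv_succ, iteratedDeriv_gK_two hφ]
  funext t
  have hA : HasDerivAt (fun s => (K ^ 2)⁻¹ * (iteratedDeriv 2 φ s - K ^ 2 * iteratedDeriv 0 φ s))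
      ((K ^ 2)⁻¹ * (iteratedDeriv 3 φ t - K ^ 2 * iteratedDeriv 1 φ t)) t :=
    ((hasDerivAt_iteratedDeriv hφ 2 t).sub ((hasDerivAt_iteratedDeriv hφ 0 t).const_mul _)).const_mul _
  have hB : HasDerivAt (fun s => -(2 * (K ^ 2)⁻¹ * K * iteratedDeriv 1 φ s))
      (-(2 * (K ^ 2)⁻¹ * K * iteratedDeriv 2 φ t)) t :=
    ((hasDerivAt_iteratedDeriv hφ 1 t).const_mul _).neg
  rw [(hasDerivAt_cos_sin K t hA hB).deriv]
  ring

/-! ## Uniform bounds for `K ≥ 1` -/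

/-- A smooth function vanishing off `[-2,2]` has bounded iterated derivatives. [folklore] -/
theorem exists_bound_iteratedDeriv (hφ : ContDiff ℝ ∞ φ) (h0 : ∀ t, 2 < |t| → φ t = 0) (k : ℕ) :
    ∃ C, 0 ≤ C ∧ ∀ t, |iteratedDeriv k φ t| ≤ C := by
  have hc : Continuous (iteratedDeriv k φ) := hφ.continuous_iteratedDeriv k (by exact_mod_cast le_top)
  have hs : HasCompactSupport (iteratedDeriv k φ) :=
    HasCompactSupport.intro isCompact_Icc fun t ht =>
      iteratedDeriv_eq_zero_of_abs_lt h0 k t (two_lt_abs_of_not_mem_Icc ht)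
  obtain ⟨C, hC⟩ := hc.bounded_above_of_compact_support hs
  refine ⟨max C 0, le_max_right _ _, fun t => ?_⟩
  exact (Real.norm_eq_abs _ ▸ hC t).trans (le_max_left _ _)

/-- `|A cos(Kt) + B sin(Kt)| ≤ |A| + |B|`. [folklore] -/
theorem abs_cos_sin_le (A B K t : ℝ) : |A * cos (K * t) + B * sin (K * t)| ≤ |A| + |B| := by
  have h1 : |A * cos (K * t)| ≤ |A| := by
    rw [abs_mul]; exact mul_le_of_le_one_right (abs_nonneg _) (abs_cos_le_one _)
  have h2 : |B * sin (K * t)| ≤ |B| := by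
    rw [abs_mul]; exact mul_le_of_le_one_right (abs_nonneg _) (abs_sin_le_one _)
  exact (abs_add_le _ _).trans (add_le_add h1 h2)

/-- For `K ≥ 1`: `(K²)⁻¹ ≤ 1`, `(K²)⁻¹ K ≤ 1`, `0 ≤ (K²)⁻¹`. [folklore] -/
theorem inv_sq_facts (hK : 1 ≤ K) : 0 ≤ (K ^ 2)⁻¹ ∧ (K ^ 2)⁻¹ ≤ 1 ∧ (K ^ 2)⁻¹ * K ≤ 1 := by
  have hK0 : 0 < K := by linarith
  have hK2 : 1 ≤ K ^ 2 := by nlinarith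
  refine ⟨by positivity, ?_, ?_⟩
  · rw [← one_div]; exact (div_le_one (by positivity)).2 hK2
  · rw [show (K ^ 2)⁻¹ * K = 1 / K by field_simp]; exact (div_le_one hK0).2 hK

/-- **`|g_K| ≤ Φ₀`** for `K ≥ 1`, `Φ₀` a bound for `|φ|`. [folklore] -/
theorem abs_gK_le (hK : 1 ≤ K) {Φ₀ : ℝ} (h : ∀ t, |iteratedDeriv 0 φ t| ≤ Φ₀) (t : ℝ) :
    |iteratedDeriv 0 (gK φ K) t| ≤ Φ₀ := by
  obtain ⟨h0, h1, -⟩ := inv_sq_facts hK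
  rw [iteratedDeriv_zero, gK_eq]
  refine (abs_cos_sin_le _ _ _ _).trans ?_
  rw [abs_zero, add_zero, abs_mul, abs_of_nonneg h0]
  calc (K ^ 2)⁻¹ * |iteratedDeriv 0 φ t| ≤ 1 * |iteratedDeriv 0 φ t| := by gcongr
    _ ≤ Φ₀ := by rw [one_mul]; exact h t

/-- **`|g_K'| ≤ Φ₁ + Φ₀`** for `K ≥ 1`. [folklore] -/
theorem abs_iteratedDeriv_gK_one_le (hφ : ContDiff ℝ ∞ φ) (hK : 1 ≤ K) {Φ₀ Φ₁ : ℝ}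
    (hΦ₀ : ∀ t, |iteratedDeriv 0 φ t| ≤ Φ₀) (hΦ₁ : ∀ t, |iteratedDeriv 1 φ t| ≤ Φ₁) (t : ℝ) :
    |iteratedDeriv 1 (gK φ K) t| ≤ Φ₁ + Φ₀ := by
  obtain ⟨h0, h1, h2⟩ := inv_sq_facts hK
  rw [iteratedDeriv_gK_one hφ]
  refine (abs_cos_sin_le _ _ _ _).trans (add_le_add ?_ ?_)
  · rw [abs_mul, abs_of_nonneg h0]
    calc (K ^ 2)⁻¹ * |iteratedDeriv 1 φ t| ≤ 1 * |iteratedDeriv 1 φ t| := by gcongr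
      _ ≤ Φ₁ := by rw [one_mul]; exact hΦ₁ t
  · rw [abs_neg, abs_mul, abs_of_nonneg (by nlinarith : 0 ≤ (K ^ 2)⁻¹ * K)]
    calc (K ^ 2)⁻¹ * K * |iteratedDeriv 0 φ t| ≤ 1 * |iteratedDeriv 0 φ t| := by gcongr
      _ ≤ Φ₀ := by rw [one_mul]; exact hΦ₀ t

/-- **`|g_K''| ≤ Φ₂ + Φ₀ + 2Φ₁`** for `K ≥ 1`. [folklore] -/
theorem abs_iteratedDeriv_gK_two_le (hφ : ContDiff ℝ ∞ φ) (hK : 1 ≤ K) {Φ₀ Φ₁ Φ₂ : ℝ}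
    (hΦ₀ : ∀ t, |iteratedDeriv 0 φ t| ≤ Φ₀) (hΦ₁ : ∀ t, |iteratedDeriv 1 φ t| ≤ Φ₁)
    (hΦ₂ : ∀ t, |iteratedDeriv 2 φ t| ≤ Φ₂) (t : ℝ) :
    |iteratedDeriv 2 (gK φ K) t| ≤ Φ₂ + Φ₀ + 2 * Φ₁ := by
  obtain ⟨h0, h1, h2⟩ := inv_sq_facts hK
  have hK0 : 0 < K := by linarith
  rw [iteratedDeriv_gK_two hφ]
  refine (abs_cos_sin_le _ _ _ _).trans ?_
  have e1 : (K ^ 2)⁻¹ * (iteratedDeriv 2 φ t - K ^ 2 * iteratedDeriv 0 φ t) =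
      (K ^ 2)⁻¹ * iteratedDeriv 2 φ t - iteratedDeriv 0 φ t := by
    field_simp
  have b1 : |(K ^ 2)⁻¹ * iteratedDeriv 2 φ t - iteratedDeriv 0 φ t| ≤ Φ₂ + Φ₀ := by
    refine (abs_sub _ _).trans (add_le_add ?_ (hΦ₀ t))
    rw [abs_mul, abs_of_nonneg h0]
    calc (K ^ 2)⁻¹ * |iteratedDeriv 2 φ t| ≤ 1 * |iteratedDeriv 2 φ t| := by gcongr
      _ ≤ Φ₂ := by rw [one_mul]; exact hΦ₂ t
  have b2 : |(-(2 * (K ^ 2)⁻¹ * K * iteratedDeriv 1 φ t))| ≤ 2 * Φ₁ := by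
    rw [abs_neg, show 2 * (K ^ 2)⁻¹ * K * iteratedDeriv 1 φ t = 2 * (((K ^ 2)⁻¹ * K) *
      iteratedDeriv 1 φ t) by ring, abs_mul, abs_mul, abs_two,
      abs_of_nonneg (by nlinarith : 0 ≤ (K ^ 2)⁻¹ * K)]
    calc 2 * ((K ^ 2)⁻¹ * K * |iteratedDeriv 1 φ t|) ≤ 2 * (1 * |iteratedDeriv 1 φ t|) := by gcongr
      _ ≤ 2 * Φ₁ := by rw [one_mul]; gcongr; exact hΦ₁ t
  rw [e1]
  linarith

/-- **`g_K''' = K φ sin(K·) + R_K` with `|R_K| ≤ Φ₃ + 3Φ₁ + 3Φ₂`** for `K ≥ 1`. [folklore] -/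
theorem abs_iteratedDeriv_gK_three_sub_le (hφ : ContDiff ℝ ∞ φ) (hK : 1 ≤ K) {Φ₁ Φ₂ Φ₃ : ℝ}
    (hΦ₁ : ∀ t, |iteratedDeriv 1 φ t| ≤ Φ₁) (hΦ₂ : ∀ t, |iteratedDeriv 2 φ t| ≤ Φ₂)
    (hΦ₃ : ∀ t, |iteratedDeriv 3 φ t| ≤ Φ₃) (t : ℝ) :
    |iteratedDeriv 3 (gK φ K) t - K * iteratedDeriv 0 φ t * sin (K * t)| ≤ Φ₃ + 3 * Φ₁ + 3 * Φ₂ := by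
  obtain ⟨h0, h1, h2⟩ := inv_sq_facts hK
  have hK0 : 0 < K := by linarith
  rw [iteratedDeriv_gK_three hφ]
  have e : (K ^ 2)⁻¹ * (iteratedDeriv 3 φ t - 3 * K ^ 2 * iteratedDeriv 1 φ t) * cos (K * t) +
      (K ^ 2)⁻¹ * (K ^ 3 * iteratedDeriv 0 φ t - 3 * K * iteratedDeriv 2 φ t) * sin (K * t) -
      K * iteratedDeriv 0 φ t * sin (K * t) =
      ((K ^ 2)⁻¹ * iteratedDeriv 3 φ t - 3 * iteratedDeriv 1 φ t) * cos (K * t) +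
        (-(3 * ((K ^ 2)⁻¹ * K) * iteratedDeriv 2 φ t)) * sin (K * t) := by
    field_simp
    ring
  rw [e]
  refine (abs_cos_sin_le _ _ _ _).trans ?_
  have b1 : |(K ^ 2)⁻¹ * iteratedDeriv 3 φ t - 3 * iteratedDeriv 1 φ t| ≤ Φ₃ + 3 * Φ₁ := by
    refine (abs_sub _ _).trans (add_le_add ?_ ?_)
    · rw [abs_mul, abs_of_nonneg h0]
      calc (K ^ 2)⁻¹ * |iteratedDeriv 3 φ t| ≤ 1 * |iteratedDeriv 3 φ t| := by gcongr
        _ ≤ Φ₃ := by rw [one_mul]; exact hΦ₃ t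
    · rw [abs_mul, show |(3 : ℝ)| = 3 by norm_num]
      gcongr
      exact hΦ₁ t
  have b2 : |(-(3 * ((K ^ 2)⁻¹ * K) * iteratedDeriv 2 φ t))| ≤ 3 * Φ₂ := by
    rw [abs_neg, abs_mul, abs_mul, show |(3 : ℝ)| = 3 by norm_num,
      abs_of_nonneg (by nlinarith : 0 ≤ (K ^ 2)⁻¹ * K)]
    calc 3 * ((K ^ 2)⁻¹ * K) * |iteratedDeriv 2 φ t| ≤ 3 * 1 * |iteratedDeriv 2 φ t| := by gcongr
      _ ≤ 3 * Φ₂ := by rw [mul_one]; gcongr; exact hΦ₂ t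
  linarith

/-! ## `L²` consequences -/

/-- If `|f| ≤ C` and `f` vanishes off `[-2,2]` then `∫ f² ≤ 4C²`. [folklore] -/
theorem integral_sq_le_of_abs_le {f : ℝ → ℝ} (hf : Continuous f) (h0 : ∀ t, 2 < |t| → f t = 0)
    {C : ℝ} (hC : ∀ t, |f t| ≤ C) : ∫ t, f t ^ 2 ≤ 4 * C ^ 2 := by
  have hle : ∀ t, f t ^ 2 ≤ (Icc (-2 : ℝ) 2).indicator (fun _ => C ^ 2) t := by
    intro t
    by_cases ht : t ∈ Icc (-2 : ℝ) 2
    · rw [indicator_of_mem ht]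
      have := hC t
      rw [← sq_abs]
      exact pow_le_pow_left₀ (abs_nonneg _) this 2
    · rw [indicator_of_notMem ht, h0 t (two_lt_abs_of_not_mem_Icc ht)]
      simp
  have hint : Integrable ((Icc (-2 : ℝ) 2).indicator fun _ => C ^ 2) :=
    IntegrableOn.integrable_indicator
      ((continuousOn_const (c := C ^ 2)).integrableOn_compact isCompact_Icc) measurableSet_Icc
  have hf2 : Integrable (fun t => f t ^ 2) := by
    refine ((hf.pow 2).integrable_of_hasCompactSupport
      (HasCompactSupport.intro (isCompact_Icc (a := (-2 : ℝ)) (b := 2)) fun t ht => ?_))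
    simp [h0 t (two_lt_abs_of_not_mem_Icc ht)]
  calc ∫ t, f t ^ 2 ≤ ∫ t, (Icc (-2 : ℝ) 2).indicator (fun _ => C ^ 2) t :=
        integral_mono hf2 hint hle
    _ = 4 * C ^ 2 := by
        rw [integral_indicator_const _ measurableSet_Icc, Real.volume_real_Icc_of_le (by norm_num),
          smul_eq_mul]
        norm_num

/-- **`Sq (gK φ K) l ≤ 4 C²`** whenever `|g_K⁽ˡ⁾| ≤ C` pointwise. [folklore] -/
theorem Sq_gK_le (hφ : ContDiff ℝ ∞ φ) (h0 : ∀ t, 2 < |t| → φ t = 0) (K : ℝ) (l : ℕ) {C : ℝ}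
    (hC : ∀ t, |iteratedDeriv l (gK φ K) t| ≤ C) : Sq (gK φ K) l ≤ 4 * C ^ 2 :=
  integral_sq_le_of_abs_le ((contDiff_gK hφ K).continuous_iteratedDeriv l (by exact_mod_cast le_top))
    (iteratedDeriv_eq_zero_of_abs_lt (gK_eq_zero h0 K) l) hC

/-- `∫_{-r}^{r} sin²(Kt) dt ≥ r − 1/K` for `K > 0`, `r ≥ 0`, as a lower bound for
`∫ φ² sin²(K·)` when `φ = 1` on `[-r, r]`. [folklore] -/
theorem integral_sq_mul_sin_sq_ge (hφc : Continuous φ) (h0 : ∀ t, 2 < |t| → φ t = 0)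
    {r : ℝ} (hr : 0 ≤ r) (h1 : ∀ t, |t| ≤ r → φ t = 1) (hK : 0 < K) :
    r - 1 / K ≤ ∫ t, (iteratedDeriv 0 φ t * sin (K * t)) ^ 2 := by
  rw [iteratedDeriv_zero]
  -- the integrand dominates the indicator of `[-r, r]` times `sin²`
  have hle : ∀ t, (Icc (-r) r).indicator (fun t => sin (K * t) ^ 2) t ≤ (φ t * sin (K * t)) ^ 2 := by
    intro t
    by_cases ht : t ∈ Icc (-r) r
    · rw [indicator_of_mem ht, h1 t (abs_le.2 ⟨by linarith [ht.1], ht.2⟩), one_mul]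
    · rw [indicator_of_notMem ht]; positivity
  have hint1 : Integrable ((Icc (-r) r).indicator fun t => sin (K * t) ^ 2) :=
    IntegrableOn.integrable_indicator
      ((continuous_sin.comp (continuous_const.mul continuous_id)).pow 2
        |>.continuousOn.integrableOn_compact isCompact_Icc) measurableSet_Icc
  have hint2 : Integrable (fun t => (φ t * sin (K * t)) ^ 2) := by
    refine ((hφc.mul (continuous_sin.comp (continuous_const.mul continuous_id))).pow 2
      |>.integrable_of_hasCompactSupport
        (HasCompactSupport.intro (isCompact_Icc (a := (-2 : ℝ)) (b := 2)) fun t ht => ?_))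
    simp [h0 t (two_lt_abs_of_not_mem_Icc ht)]
  refine le_trans ?_ (integral_mono hint1 hint2 hle)
  rw [integral_indicator measurableSet_Icc, integral_Icc_eq_integral_Ioc,
    ← intervalIntegral.integral_of_le (by linarith : -r ≤ r),
    intervalIntegral.integral_comp_mul_left (fun x => sin x ^ 2) hK.ne', integral_sin_sq]
  have hsc : sin (K * r) * cos (K * r) ≤ 1 := by
    nlinarith [sin_sq_add_cos_sq (K * r), sq_nonneg (sin (K * r) - cos (K * r))]
  have key : K⁻¹ • ((sin (K * -r) * cos (K * -r) - sin (K * r) * cos (K * r) + K * r - K * -r) / 2) =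
      r - K⁻¹ * (sin (K * r) * cos (K * r)) := by
    rw [smul_eq_mul]
    simp only [mul_neg, sin_neg, cos_neg, neg_mul]
    field_simp
    ring
  rw [key, one_div]
  have h2 : K⁻¹ * (sin (K * r) * cos (K * r)) ≤ K⁻¹ * 1 :=
    mul_le_mul_of_nonneg_left hsc (inv_nonneg.2 hK.le)
  linarith

/-- **Growth of `‖g_K'''‖₂²`.** If `φ = 1` on `[-r, r]` then for `K ≥ 1`,
`Sq (gK φ K) 3 ≥ K² r/2 − K/2 − 4 C₃²` where `C₃` bounds `|g_K''' − K φ sin(K·)|`. [folklore] -/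
theorem Sq_gK_three_ge (hφ : ContDiff ℝ ∞ φ) (h0 : ∀ t, 2 < |t| → φ t = 0) {r : ℝ} (hr : 0 ≤ r)
    (h1 : ∀ t, |t| ≤ r → φ t = 1) (hK : 1 ≤ K) {C₃ : ℝ}
    (hC₃ : ∀ t, |iteratedDeriv 3 (gK φ K) t - K * iteratedDeriv 0 φ t * sin (K * t)| ≤ C₃) :
    K ^ 2 * r / 2 - K / 2 - 4 * C₃ ^ 2 ≤ Sq (gK φ K) 3 := by
  have hK0 : 0 < K := by linarith
  set R : ℝ → ℝ := fun t => iteratedDeriv 3 (gK φ K) t - K * iteratedDeriv 0 φ t * sin (K * t) with hR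
  have hgc : Continuous (iteratedDeriv 3 (gK φ K)) :=
    (contDiff_gK hφ K).continuous_iteratedDeriv 3 three_le_infty
  have hφc : Continuous (iteratedDeriv 0 φ) := hφ.continuous_iteratedDeriv 0 zero_le_infty
  have hms : Continuous (fun t => K * iteratedDeriv 0 φ t * sin (K * t)) :=
    (continuous_const.mul hφc).mul (continuous_sin.comp (continuous_const.mul continuous_id))
  have hRc : Continuous R := hgc.sub hms
  have hR0 : ∀ t, 2 < |t| → R t = 0 := by
    intro t ht
    simp [hR, iteratedDeriv_eq_zero_of_abs_lt (gK_eq_zero h0 K) 3 t ht, h0 t ht]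
  -- pointwise: `(g''')² ≥ ½ (Kφ sin)² − R²`
  have hpt : ∀ t, 2⁻¹ * (K ^ 2 * (iteratedDeriv 0 φ t * sin (K * t)) ^ 2) - R t ^ 2 ≤
      iteratedDeriv 3 (gK φ K) t ^ 2 := by
    intro t
    have e : iteratedDeriv 3 (gK φ K) t = K * iteratedDeriv 0 φ t * sin (K * t) + R t := by
      simp [hR]
    rw [e]
    nlinarith [sq_nonneg (K * iteratedDeriv 0 φ t * sin (K * t) + 2 * R t)]
  have hI1 : Integrable (fun t => (iteratedDeriv 0 φ t * sin (K * t)) ^ 2) := by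
    refine ((hφc.mul (continuous_sin.comp (continuous_const.mul continuous_id))).pow 2
      |>.integrable_of_hasCompactSupport
        (HasCompactSupport.intro (isCompact_Icc (a := (-2 : ℝ)) (b := 2)) fun t ht => ?_))
    simp [h0 t (two_lt_abs_of_not_mem_Icc ht)]
  have hIR : Integrable (fun t => R t ^ 2) :=
    (hRc.pow 2).integrable_of_hasCompactSupport
      (HasCompactSupport.intro (isCompact_Icc (a := (-2 : ℝ)) (b := 2)) fun t ht => by
        simp [hR0 t (two_lt_abs_of_not_mem_Icc ht)])
  have hIg : Integrable (fun t => iteratedDeriv 3 (gK φ K) t ^ 2) :=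
    (hgc.pow 2).integrable_of_hasCompactSupport
      (HasCompactSupport.intro (isCompact_Icc (a := (-2 : ℝ)) (b := 2)) fun t ht => by
        simp [iteratedDeriv_eq_zero_of_abs_lt (gK_eq_zero h0 K) 3 t (two_lt_abs_of_not_mem_Icc ht)])
  have hmono : ∫ t, (2⁻¹ * (K ^ 2 * (iteratedDeriv 0 φ t * sin (K * t)) ^ 2) - R t ^ 2) ≤
      ∫ t, iteratedDeriv 3 (gK φ K) t ^ 2 :=
    integral_mono (((hI1.const_mul (K ^ 2)).const_mul 2⁻¹).sub hIR) hIg hpt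
  rw [integral_sub ((hI1.const_mul (K ^ 2)).const_mul 2⁻¹) hIR, integral_const_mul,
    integral_const_mul] at hmono
  have hsin := integral_sq_mul_sin_sq_ge hφ.continuous h0 hr h1 hK0
  have hR2 := integral_sq_le_of_abs_le hRc hR0 hC₃
  unfold Sq
  have : 2⁻¹ * (K ^ 2 * (r - 1 / K)) ≤ 2⁻¹ * (K ^ 2 * ∫ t, (iteratedDeriv 0 φ t * sin (K * t)) ^ 2) := by
    gcongr
  have e : 2⁻¹ * (K ^ 2 * (r - 1 / K)) = K ^ 2 * r / 2 - K / 2 := by field_simp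
  linarith

end Osc

end Sep3

end Summit.NavierStokesRegularity.FunctionalMining
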